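import Literature.Analysis.FluidPDE.ChenHouContinuation
import Literature.Analysis.FluidPDE.ClassicalSolutionGlue
import HarnessLib

/-!
# Maximal smooth Euler flows in the periodic cylinder: `Ferrari1993_periodicCylinderEulerBKM`
from local existence and continuation

Topic `Literature/Analysis/FluidPDE`. Proof-architecture file for the named fact
`Literature.Analysis.FluidPDE.Ferrari1993_periodicCylinderEulerBKM` (`ChenHouContinuation.lean`): smooth
axisymmetric axially periodic divergence-free data, tangential on the wall of the cylinder
`{r < 1}`, launch a classical solution of the incompressible Euler equations, smooth up to the
boundary, which is either global or lives on a bounded `[0, T_m)` on which the vorticity is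
unbounded. That fact bundles three things which the sources print separately:

1. **local existence** of a solution in the smooth symmetric class (Kato–Lai 1984, Thm I
   (existence and uniqueness in `C([0,T]; H^s_σ(Ω))`, `s ≥ [m/2] + 2`, existence time depending
   only on the `H^{s₀}` size of the data) and Thm II (regularity: `u(t) ∈ C^∞(Ω̄)` for `C^∞`
   data), p. 17 of the held text; quoted with the pressure as Ferrari 1993, Thm 1, p. 279);
2. the **continuation criterion** (Ferrari 1993, Thm 2, p. 279: if `[0, T̂)` is the maximal
   interval of existence of the solution `u` in the class `C([0,T]; H^s(Ω))`, `s ≥ 3`, then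
   `∫₀^{T̂} |ω(·,t)|_{L^∞(Ω)} dt = ∞`, in particular `sup_{(0,T̂)} |ω|_{L^∞} = ∞`; general
   topology: Shirota–Yanagisawa 1993), whose contrapositive says that a solution with bounded
   vorticity on `[0, T)` can be *continued* past `T`;
3. the passage from 1–2 to a **maximal** solution with the blow-up dichotomy (Ferrari 1993,
   p. 277: "if `[0, T̂)` is the maximal interval of existence …"; Beale–Kato–Majda 1984 §1), which
   is bookkeeping: order the solutions issuing from `u₀` by extension, take a maximal one (Zorn),
   and observe that a bounded vorticity on a bounded maximal interval would contradict 2.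

This file vendors 2 as a named fact in the solution class of the target fact,

* `Literature.Analysis.FluidPDE.Ferrari1993_periodicCylinderContinuation`,

takes 1 as an explicit hypothesis (the local-existence statement in the solution class of the
target fact, written out), and **proves** 3:
`Ferrari1993_periodicCylinderEulerBKM_of_localExistence_of_continuation : 1 → 2 → target`.
The local-existence hypothesis 1 is Kato–Lai's Thm I/II in the periodic cylinder, carried in the
tree by ONE named fact, `KatoLai1984_periodicCylinderUniformExistence`
(`Ferrari1993Continuation.lean`: Thm I with its printed uniformity clause "`T` and `K` may be
chosen depending only on `Φ_{s₀}`", no symmetry), from which `KatoLaiUniformExistenceBridge.lean`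
derives 1 (`KatoLai1984_periodicCylinderLocalExistence_of_uniformExistence`: axisymmetry
propagates by the uniqueness clause of Thm I, discharged as
`KatoLai1984_periodicCylinderUniqueness_holds`) and feeds it, together with 2 derived from
Ferrari's a-priori `H³` bound, into the theorem proved here
(`Ferrari1993_periodicCylinderEulerBKM_of_H3Bound_of_uniformExistence`). The earlier named-fact
rendering of 1, `KatoLai1984_periodicCylinderLocalExistence`, is retired in favour of that
derivation (one printed theorem, one named fact; D-0026). Discharging the target (`…_holds`) is
thereby reduced to the analytic facts of the Kato–Lai/Ferrari theory on the periodic cylinder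
(Sobolev/elliptic theory up to a curved boundary that Mathlib does not have).

## The solution class, the local-existence hypothesis and the continuation fact

`IsCylinderEulerSolution L S u₀ u p` is the conjunction quantified in the target fact: `(u, p)`
is a classical Euler solution (`IsClassicalEulerOnDomain`, slip condition with normal `eR`,
`f = 0`) in `unitCylinder = {r < 1}` on the time set `S`, `u 0 = u₀`, `u` and `p` are `C^∞` on
`S × closure {r < 1}` jointly in `(t, x)`, and every time slice has axisymmetric velocity and
`L`-periodic velocity and pressure.

* Local existence (1, hypothesis `hA` of the assembly): admissible data ⟹ `∃ T > 0` and a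
  solution of the class on `[0, T)` (Kato–Lai 1984 Thm I/II; in the tree from
  `KatoLai1984_periodicCylinderUniformExistence`, see above).
* Continuation (2): a solution of the class on a bounded `[0, T)` whose vorticity is bounded on
  `[0, T) × {r < 1}` is continued by a solution of the class on some `[0, T')`, `T' > T`, whose
  **velocity** agrees with `u` on `[0, T) × closure {r < 1}`. The pressure of the continuation
  is not asserted to agree: the class determines `p(t, ·)` only up to an additive function of
  time, and a given normalisation `c(t)`, smooth on `[0, T)`, need not extend continuously to
  `T`; asserting `p' = p` would make the fact false for such representatives. This is the
  contrapositive of Ferrari's Thm 2 in its weakest printed form (`sup |ω| < ∞` instead of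
  `∫ |ω|_{L^∞} dt < ∞`), combined with Kato–Lai Thm I/II for the restart at time `T`.

## The proof of 3 (all folklore bookkeeping, no analysis beyond the mean value theorem)

Candidates are solutions of the class on `timeSet T = {t ≥ 0 | t < T}`, `T ∈ (0, ∞]`
(`T : ℝ≥0∞`, so that `[0, ∞)` is the case `T = ⊤`), with pressure normalised by `p(t, 0) = 0`
(the axis point `0` lies in the cylinder), preordered by "`T ≤ T'` and the velocities and
pressures agree on `timeSet T × closure {r < 1}`". A nonempty chain has an upper bound: the
union (`chainSup`), whose fields at time `t` are those of some member alive at `t`; joint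
smoothness is local (`contDiffOn_of_locally_contDiffOn`: each `timeSet Tᵢ × closure Ω` is
relatively open), and the momentum equation transfers because the one-sided time derivative
within `timeSet T` at `t < Tᵢ` only sees times `< Tᵢ` (`timeDerivWithin_eq_of_eqOn`). Local
existence makes the candidate type nonempty; Zorn (`zorn_le_nonempty`) gives a maximal
candidate `m`. If `m.T = ⊤` the solution is global. Otherwise `m` lives on `[0, T_m)`; were its
vorticity bounded there, the continuation fact would give a solution on `[0, T')`, `T' > T_m`,
with the same velocity on `[0, T_m) × closure Ω`, hence (momentum equation: the velocity
determines `∇p`; convexity of the cylinder and continuity up to the wall: it determines the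
normalised pressure, `pressure_sub_apply_zero_eq_of_velocity_eq`) a candidate above `m` with a
longer life — contradicting maximality. So the vorticity is unbounded on `[0, T_m) × {r < 1}`.

## Faithfulness / what is NOT here

* Nothing is asserted beyond the target fact's own rendering: the continuation fact and the
  local-existence hypothesis are stated in exactly its solution class, for the periodic
  cylinder, with the same adaptation caveat — the
  printed theorems concern bounded domains of `ℝ³` with smooth boundary, and their use for the
  axially periodic cylinder `{r ≤ 1} × ℝ/Lℤ` (a compact flat manifold with boundary) is the use
  made in print by Luo–Hou 2014 §4.4 and Chen–Hou (CMP 2021 §9; Part I §6.5), without a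
  dedicated reference in our holdings (Ebin–Marsden 1970 treats compact manifolds with boundary;
  not held). Uniqueness (Kato–Lai Thm I) is not used here: the maximal-solution argument is
  run with Zorn's lemma instead of gluing "the" solution (it is vendored downstream,
  `KatoLai1984_periodicCylinderUniqueness` of `KatoLaiPeriodicCylinder.lean`, for the propagation
  of axisymmetry and for Ferrari's restart argument, and discharged there).
* `Ferrari1993_periodicCylinderEulerBKM_holds` itself is **not** here: it needs local existence
  and continuation discharged (Sobolev spaces `H^s` on the cylinder, the Helmholtz projection
  and the Neumann problem up to the boundary, Kato's quasi-linear existence theorem, the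
  logarithmic div–curl estimate of Ferrari §2) — a theory absent from Mathlib.

Mathlib/tree search: no maximal-solution construction for `IsClassicalEulerOnDomain`
(`lean search 'IsClassicalEulerOnDomain'`: `AxisymmetricEuler`, `Axisymmetric`, `ChenHou*` only);
the whole-space Navier–Stokes analogue of the gluing step is `IsClassicalNSSolutionOn.glue`
(`ClassicalSolutionGlue.lean`, two-sided time derivatives at interior times), the `L³`-mild
analogue is `KatoMaximalTime.lean` (supremum of lifespans, needs uniqueness). Used from Mathlib:
`zorn_le_nonempty`, `lt_biSup_iff`, `le_biSup`, `ENNReal.ofReal_lt_ofReal_iff`,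
`contDiffOn_of_locally_contDiffOn`, `derivWithin_inter`, `derivWithin_congr`,
`Filter.EventuallyEq.fderiv_eq`, `Convex.eqOn_of_fderivWithin_eq`, `Set.EqOn.of_subset_closure`,
`Convex.linear_preimage`.
-/

noncomputable section

open MeasureTheory Set Function Filter Topology TopologicalSpace WithLp
open scoped ContDiff NNReal ENNReal InnerProductSpace RealInnerProductSpace

namespace Literature.Analysis.FluidPDE

/-- Local notation for physical space `ℝ³ = EuclideanSpace ℝ (Fin 3)`. -/
local notation "ℝ³" => EuclideanSpace ℝ (Fin 3)

/-! ### Geometry of the unit cylinder -/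

/-- The horizontal projection `x ↦ (x₀, x₁, 0)` of `ℝ³` onto the plane through the origin
orthogonal to the axis, as a linear map; its norm is the cylindrical radius
(`norm_horizontalProj`). [folklore] -/
def horizontalProj : ℝ³ →ₗ[ℝ] ℝ³ where
  toFun x := toLp 2 ![x 0, x 1, 0]
  map_add' x y := by
    ext i
    fin_cases i <;> simp
  map_smul' c x := by
    ext i
    fin_cases i <;> simp

/-- `‖(x₀, x₁, 0)‖ = r = cylRadius x`. [folklore] -/
theorem norm_horizontalProj (x : ℝ³) : ‖horizontalProj x‖ = cylRadius x := by
  rw [EuclideanSpace.norm_eq, cylRadius]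
  congr 1
  simp [horizontalProj, Fin.sum_univ_three]

/-- The open unit cylinder `{r < 1}` is convex: it is the preimage of the open unit ball under
the horizontal projection. [folklore] -/
theorem convex_unitCylinder : Convex ℝ (unitCylinder : Set ℝ³) := by
  have h : (unitCylinder : Set ℝ³) = horizontalProj ⁻¹' Metric.ball (0 : ℝ³) 1 := by
    ext x
    rw [mem_preimage, Metric.mem_ball, dist_zero_right, norm_horizontalProj]
    rfl
  rw [h]
  exact (convex_ball (0 : ℝ³) 1).linear_preimage horizontalProj

/-- The origin (a point of the axis) lies in the unit cylinder: `r(0) = 0 < 1`. [folklore] -/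
theorem zero_mem_unitCylinder : (0 : ℝ³) ∈ (unitCylinder : Set ℝ³) := by
  rw [SetLike.mem_coe, mem_unitCylinder]
  simp [cylRadius]

/-! ### One-sided time derivatives on relatively open time subsets -/

section TimeDeriv

variable {X : Type*} {F : Type*} [NormedAddCommGroup F] [NormedSpace ℝ F]

/-- **The one-sided time derivative is local in the time set.** If `S₁ ⊆ S₂` coincide near `t`
(`S₂ ∩ O ⊆ S₁` for a neighbourhood `O` of `t`) and two fields agree at the point `x` for all
times in `S₁`, then their time derivatives within `S₁` resp. `S₂` at `(t, x)` agree (Mathlib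
`derivWithin_inter`, `derivWithin_congr`). This is what makes the momentum equation of a
solution on `[0, Tᵢ)` the momentum equation of an extension on `[0, T)`, `T ≥ Tᵢ`, at times
`t < Tᵢ`, including the one-sided derivative at `t = 0`. [folklore] -/
theorem timeDerivWithin_eq_of_eqOn {S₁ S₂ : Set ℝ} {w₁ w₂ : ℝ → X → F} (hsub : S₁ ⊆ S₂)
    {t : ℝ} {O : Set ℝ} (hO : O ∈ 𝓝 t) (hOS : S₂ ∩ O ⊆ S₁) {x : X}
    (heq : ∀ s ∈ S₁, w₁ s x = w₂ s x) (ht : t ∈ S₁) :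
    timeDerivWithin S₁ w₁ t x = timeDerivWithin S₂ w₂ t x := by
  simp only [timeDerivWithin_apply]
  have hS : S₁ ∩ O = S₂ ∩ O :=
    Subset.antisymm (inter_subset_inter_left _ hsub) fun s hs => ⟨hOS hs, hs.2⟩
  rw [← derivWithin_inter hO, derivWithin_congr (f := fun s => w₂ s x) (fun s hs => heq s hs.1)
    (heq t ht), hS, derivWithin_inter hO]

end TimeDeriv

/-! ### The velocity determines the pressure gradient, and the normalised pressure -/

section Pressure

variable {E : Type*} [NormedAddCommGroup E] [InnerProductSpace ℝ E] [FiniteDimensional ℝ E]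

/-- **The velocity determines the pressure gradient** (classical Euler solutions on a domain):
if two solutions with the same force have velocities agreeing on `S₁ × closure Ω`, where the
time set `S₁ ⊆ S₂` of the first coincides with `S₂` near `t ∈ S₁`, then
`∇p₁(t, x) = ∇p₂(t, x)` at every `x ∈ Ω` (subtract the momentum equations: the one-sided time
derivatives agree by `timeDerivWithin_eq_of_eqOn`, the convective terms because the velocities
agree near the interior point `x`). [folklore] -/
theorem IsClassicalEulerOnDomain.gradient_pressure_eq_of_velocity_eq {S₁ S₂ : Set ℝ}
    {Ω : Opens E} {n : E → E} {f u₁ u₂ : ℝ → E → E} {p₁ p₂ : ℝ → E → ℝ}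
    (h₁ : IsClassicalEulerOnDomain S₁ Ω n f u₁ p₁) (h₂ : IsClassicalEulerOnDomain S₂ Ω n f u₂ p₂)
    (hsub : S₁ ⊆ S₂) {t : ℝ} (ht : t ∈ S₁) {O : Set ℝ} (hO : O ∈ 𝓝 t) (hOS : S₂ ∩ O ⊆ S₁)
    (hu : ∀ s ∈ S₁, ∀ y ∈ closure (Ω : Set E), u₁ s y = u₂ s y) {x : E} (hx : x ∈ Ω) :
    gradient (p₁ t) x = gradient (p₂ t) x := by
  have hd : timeDerivWithin S₁ u₁ t x = timeDerivWithin S₂ u₂ t x :=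
    timeDerivWithin_eq_of_eqOn hsub hO hOS (fun s hs => hu s hs x (subset_closure hx)) ht
  have hev : u₁ t =ᶠ[𝓝 x] u₂ t :=
    Filter.eventuallyEq_of_mem (Ω.isOpen.mem_nhds hx) fun y hy => hu t ht y (subset_closure hy)
  have hc : convect (u₁ t) (u₁ t) x = convect (u₂ t) (u₂ t) x := by
    simp only [convect_apply]
    rw [hev.fderiv_eq, hev.eq_of_nhds]
  have hm₁ := h₁.momentum t ht x hx
  have hm₂ := h₂.momentum t (hsub ht) x hx
  rw [hd, hc, hm₂] at hm₁
  -- `hm₁ : -∇p₂ + f = -∇p₁ + f`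
  have := add_right_cancel hm₁
  rw [neg_inj] at this
  exact this.symm

end Pressure

/-- **The velocity determines the normalised pressure in the cylinder.** Under the hypotheses
of `gradient_pressure_eq_of_velocity_eq` for `Ω = {r < 1}`, the pressures normalised at the axis
point `0` agree on the *closed* cylinder at time `t`:
`p₁(t, y) − p₁(t, 0) = p₂(t, y) − p₂(t, 0)` for `r(y) ≤ 1` (equal gradients on the convex open
cylinder and equality at `0 ∈ {r < 1}` give equality on `{r < 1}`, Mathlib
`Convex.eqOn_of_fderivWithin_eq`; continuity up to the wall extends it to the closure,
`Set.EqOn.of_subset_closure`). [folklore] -/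
theorem IsClassicalEulerOnDomain.pressure_sub_apply_zero_eq_of_velocity_eq {S₁ S₂ : Set ℝ}
    {f u₁ u₂ : ℝ → ℝ³ → ℝ³} {p₁ p₂ : ℝ → ℝ³ → ℝ}
    (h₁ : IsClassicalEulerOnDomain S₁ unitCylinder eR f u₁ p₁)
    (h₂ : IsClassicalEulerOnDomain S₂ unitCylinder eR f u₂ p₂)
    (hsub : S₁ ⊆ S₂) {t : ℝ} (ht : t ∈ S₁) {O : Set ℝ} (hO : O ∈ 𝓝 t) (hOS : S₂ ∩ O ⊆ S₁)
    (hu : ∀ s ∈ S₁, ∀ y ∈ closure (unitCylinder : Set ℝ³), u₁ s y = u₂ s y)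
    {y : ℝ³} (hy : y ∈ closure (unitCylinder : Set ℝ³)) :
    p₁ t y - p₁ t 0 = p₂ t y - p₂ t 0 := by
  have hp₁ : ContDiffOn ℝ 1 (p₁ t) (closure (unitCylinder : Set ℝ³)) :=
    contDiffOn_slice_of_contDiffOn_uncurry h₁.smooth.2 ht
  have hp₂ : ContDiffOn ℝ 1 (p₂ t) (closure (unitCylinder : Set ℝ³)) :=
    contDiffOn_slice_of_contDiffOn_uncurry h₂.smooth.2 (hsub ht)
  have hopen : IsOpen (unitCylinder : Set ℝ³) := unitCylinder.isOpen
  have hd₁ : DifferentiableOn ℝ (fun z => p₁ t z - p₁ t 0) (unitCylinder : Set ℝ³) :=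
    ((hp₁.differentiableOn one_ne_zero).mono subset_closure).sub_const _
  have hd₂ : DifferentiableOn ℝ (fun z => p₂ t z - p₂ t 0) (unitCylinder : Set ℝ³) :=
    ((hp₂.differentiableOn one_ne_zero).mono subset_closure).sub_const _
  have heq : EqOn (fun z => p₁ t z - p₁ t 0) (fun z => p₂ t z - p₂ t 0)
      (unitCylinder : Set ℝ³) := by
    refine convex_unitCylinder.eqOn_of_fderivWithin_eq hd₁ hd₂ hopen.uniqueDiffOn
      (fun z hz => ?_) zero_mem_unitCylinder (by simp)
    rw [fderivWithin_of_isOpen hopen hz, fderivWithin_of_isOpen hopen hz, fderiv_sub_const,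
      fderiv_sub_const]
    have hg := h₁.gradient_pressure_eq_of_velocity_eq h₂ hsub ht hO hOS hu hz
    unfold gradient at hg
    exact (InnerProductSpace.toDual ℝ ℝ³).symm.injective hg
  have hc₁ : ContinuousOn (fun z => p₁ t z - p₁ t 0) (closure (unitCylinder : Set ℝ³)) :=
    hp₁.continuousOn.sub continuousOn_const
  have hc₂ : ContinuousOn (fun z => p₂ t z - p₂ t 0) (closure (unitCylinder : Set ℝ³)) :=
    hp₂.continuousOn.sub continuousOn_const
  exact heq.of_subset_closure hc₁ hc₂ subset_closure Subset.rfl hy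

/-! ### The solution class of the target fact -/

/-- **Smooth symmetric classical Euler solutions in the periodic cylinder** — the conjunction
quantified in `Ferrari1993_periodicCylinderEulerBKM` (and in `ChenHou2022_aprioriBlowupEstimates`),
on a time set `S`: `(u, p)` is a classical solution of the incompressible Euler equations
(`f = 0`) in `{r < 1}` with the slip condition `u · e_r = 0` on `{r = 1}`
(`IsClassicalEulerOnDomain S unitCylinder eR 0 u p`), `u(0) = u₀`, `u` and `p` are `C^∞` on
`S × closure {r < 1}` jointly in `(t, x)`, and for every `t ∈ S` the velocity is axisymmetric
and the velocity and the pressure are `L`-periodic in `z` (Kato–Lai 1984 Thm II: the solution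
is `C^∞(Ω̄)` for `C^∞` data; Chen–Hou's setting, Part I §6 p. 53). [folklore] -/
structure IsCylinderEulerSolution (L : ℝ) (S : Set ℝ) (u₀ : ℝ³ → ℝ³) (u : ℝ → ℝ³ → ℝ³)
    (p : ℝ → ℝ³ → ℝ) : Prop where
  /-- The Euler equations in `{r < 1}` with the slip condition, on the time set `S`. -/
  euler : IsClassicalEulerOnDomain S unitCylinder eR 0 u p
  /-- The initial datum. -/
  initial : u 0 = u₀
  /-- The velocity is `C^∞` up to the boundary, jointly in `(t, x)`. -/
  smooth_velocity : ContDiffOn ℝ ∞ (uncurry u) (S ×ˢ closure (unitCylinder : Set ℝ³))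
  /-- The pressure is `C^∞` up to the boundary, jointly in `(t, x)`. -/
  smooth_pressure : ContDiffOn ℝ ∞ (uncurry p) (S ×ˢ closure (unitCylinder : Set ℝ³))
  /-- Axisymmetric velocity, `L`-periodic velocity and pressure. -/
  symmetric : ∀ t ∈ S, IsAxisymmetric (u t) ∧ IsAxiallyPeriodic L (u t) ∧ IsAxiallyPeriodic L (p t)

section Normalise

variable {X : Type*} [NormedAddCommGroup X] [NormedSpace ℝ X]
variable {F : Type*} [NormedAddCommGroup F] [NormedSpace ℝ F]

/-- Subtracting the value at the spatial origin preserves joint smoothness on `S × K` when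
`0 ∈ K`: `(t, x) ↦ p(t, x) − p(t, 0)` is `Cⁿ` there if `p` is. [folklore] -/
theorem contDiffOn_uncurry_sub_apply_zero {S : Set ℝ} {K : Set X} {p : ℝ → X → F}
    {n : WithTop ℕ∞} (h : ContDiffOn ℝ n (uncurry p) (S ×ˢ K)) (hK : (0 : X) ∈ K) :
    ContDiffOn ℝ n (uncurry fun t x => p t x - p t 0) (S ×ˢ K) := by
  have h0 : ContDiffOn ℝ n (fun z : ℝ × X => uncurry p (z.1, (0 : X))) (S ×ˢ K) :=
    h.comp (contDiff_fst.prodMk contDiff_const).contDiffOn fun z hz => ⟨hz.1, hK⟩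
  exact h.sub h0

end Normalise

/-- **Normalising the pressure at the axis point** `0 ∈ {r < 1}` keeps a solution in the class:
`(u, p − p(·, 0))` is again a solution (`∇(p − c) = ∇p`, constants are periodic, and joint
smoothness is preserved, `contDiffOn_uncurry_sub_apply_zero`). [folklore] -/
theorem IsCylinderEulerSolution.normalise {L : ℝ} {S : Set ℝ} {u₀ : ℝ³ → ℝ³} {u : ℝ → ℝ³ → ℝ³}
    {p : ℝ → ℝ³ → ℝ} (h : IsCylinderEulerSolution L S u₀ u p) :
    IsCylinderEulerSolution L S u₀ u (fun t x => p t x - p t 0) where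
  euler :=
    { smooth := ⟨h.euler.smooth.1, contDiffOn_uncurry_sub_apply_zero h.euler.smooth.2
        (subset_closure zero_mem_unitCylinder)⟩
      momentum := fun t ht x hx => by
        rw [gradient_sub_const]
        exact h.euler.momentum t ht x hx
      divFree := h.euler.divFree
      slip := h.euler.slip }
  initial := h.initial
  smooth_velocity := h.smooth_velocity
  smooth_pressure := contDiffOn_uncurry_sub_apply_zero h.smooth_pressure
    (subset_closure zero_mem_unitCylinder)
  symmetric t ht := ⟨(h.symmetric t ht).1, (h.symmetric t ht).2.1, fun x => by
    simp only [(h.symmetric t ht).2.2 x]⟩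

/-! ### The continuation fact -/

/-- **Continuation of smooth Euler flows in the periodic cylinder past a time of bounded
vorticity** (Ferrari 1993, Thm 2, p. 279: for a bounded simply connected `Ω ⊂ ℝ³` with smooth
boundary and a solution `u` of (1)–(3) in the class `C([0,T]; H^s(Ω))`, `s ≥ 3`, if `T = T̂` is
the first time such that `u` is not contained in this class then `∫₀^{T̂} |ω(·,t)|_{L^∞(Ω)} dt = ∞`
and in particular `sup_{t ∈ (0,T̂)} |ω(·,t)|_{L^∞(Ω)} = ∞`; general topology: Shirota–Yanagisawa
1993; the restart past `T̂` when `u(T̂) ∈ H^s` exists is Kato–Lai 1984 Thm I/II = Ferrari Thm 1).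
**Rendering** (contrapositive, weakest printed form, in the class of the target fact): if
`(u, p)` is a solution of the class `IsCylinderEulerSolution L [0, T) u₀` with `0 < T < ∞` whose
vorticity is bounded on `[0, T) × {r < 1}`, then `[0, T)` is not the maximal interval of
existence: there are `T' > T` and a solution `(u', p')` of the class on `[0, T')` whose velocity
continues `u`, `u' = u` on `[0, T) × closure {r < 1}`. Only the velocity is continued: the class
fixes `p(t, ·)` up to an additive function of time alone, and a representative whose
normalisation `c(t)` does not extend continuously to `t = T` has no smooth continuation `p' = p`;
the continuation's pressure may be taken to be the (smooth) Neumann pressure of `u'`. Adaptation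
caveat (bounded domain → periodic cylinder) as in the target fact: the printed theorems are for
bounded domains of `ℝ³`; the periodic cylinder `{r ≤ 1} × ℝ/Lℤ` is a compact flat manifold with
boundary (the use made of them by Luo–Hou 2014 §4.4 and Chen–Hou, CMP 2021 §9); the a-priori
`H^s` bound (7) of Ferrari's proof for every `s` and the `s`-independent existence time of Thm 1
give the restart in `C^∞`. [cite: Ferrari1993, Thm 2 (p. 279) with Thm 1]
[cite: ShirotaYanagisawa1993, Theorem p. 77 with estimate (4) (general topology)] [cite: KatoLai1984, Thm I and Thm II (p. 17, restart)] -/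
def Ferrari1993_periodicCylinderContinuation : Prop :=
  ∀ (L : ℝ) (_hL : 0 < L) (u₀ : ℝ³ → ℝ³) (T : ℝ) (_hT : 0 < T) (u : ℝ → ℝ³ → ℝ³)
    (p : ℝ → ℝ³ → ℝ) (_hsol : IsCylinderEulerSolution L (Ico 0 T) u₀ u p)
    (_hbdd : ∃ C : ℝ, ∀ t ∈ Ico (0 : ℝ) T, ∀ x ∈ (unitCylinder : Set ℝ³), ‖curl (u t) x‖ ≤ C),
    ∃ T' : ℝ, T < T' ∧ ∃ (u' : ℝ → ℝ³ → ℝ³) (p' : ℝ → ℝ³ → ℝ),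
      IsCylinderEulerSolution L (Ico 0 T') u₀ u' p' ∧
      ∀ t ∈ Ico (0 : ℝ) T, ∀ x ∈ closure (unitCylinder : Set ℝ³), u' t x = u t x

/-! ### Maximal solutions by Zorn's lemma -/

/-- The time set `{t ≥ 0 | t < T}` of an extended positive time `T ∈ [0, ∞]`: `[0, T)` for
finite `T` (`timeSet_ofReal`), `[0, ∞)` for `T = ⊤` (`timeSet_top`). [folklore] -/
def timeSet (T : ℝ≥0∞) : Set ℝ :=
  {t | 0 ≤ t ∧ ENNReal.ofReal t < T}

/-- `timeSet ⊤ = [0, ∞)`. [folklore] -/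
theorem timeSet_top : timeSet ⊤ = Ici 0 := by
  ext t
  simp [timeSet]

/-- `timeSet T = [0, T)` for a positive real `T`. [folklore] -/
theorem timeSet_ofReal {T : ℝ} (hT : 0 < T) : timeSet (ENNReal.ofReal T) = Ico 0 T := by
  ext t
  simp only [timeSet, mem_setOf_eq, mem_Ico, ENNReal.ofReal_lt_ofReal_iff hT]

/-- The time sets increase with `T`. [folklore] -/
theorem timeSet_mono {T T' : ℝ≥0∞} (h : T ≤ T') : timeSet T ⊆ timeSet T' :=
  fun _ ht => ⟨ht.1, ht.2.trans_le h⟩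

/-- `0 ∈ timeSet T` for `T > 0`. [folklore] -/
theorem zero_mem_timeSet {T : ℝ≥0∞} (h : 0 < T) : (0 : ℝ) ∈ timeSet T :=
  ⟨le_rfl, by simpa using h⟩

/-- The set of real times `{t | t < T}` below an extended time is open. [folklore] -/
theorem isOpen_setOf_ofReal_lt (T : ℝ≥0∞) : IsOpen {t : ℝ | ENNReal.ofReal t < T} :=
  isOpen_lt ENNReal.continuous_ofReal continuous_const

/-- `timeSet T` is the part of `timeSet T'`, `T ≤ T'`, below `T` (relative openness). [folklore] -/
theorem timeSet_inter_setOf_lt {T T' : ℝ≥0∞} (h : T ≤ T') :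
    timeSet T' ∩ {t : ℝ | ENNReal.ofReal t < T} = timeSet T :=
  Subset.antisymm (fun _ ht => ⟨ht.1.1, ht.2⟩) fun _ ht => ⟨timeSet_mono h ht, ht.2⟩

/-- **Candidates for the maximal solution**: a solution of the class on `timeSet T`,
`T ∈ (0, ∞]`, issuing from `u₀`, with pressure normalised by `p(t, 0) = 0`
(Ferrari 1993, p. 277: "if `[0, T̂)` is the maximal interval of existence of a smooth solution";
Beale–Kato–Majda 1984 §1). Bookkeeping structure for the Zorn argument of
`Ferrari1993_periodicCylinderEulerBKM_of_localExistence_of_continuation`. [folklore] -/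
structure CylinderEulerCandidate (L : ℝ) (u₀ : ℝ³ → ℝ³) where
  /-- The lifespan, `∞` allowed. -/
  T : ℝ≥0∞
  /-- The velocity. -/
  u : ℝ → ℝ³ → ℝ³
  /-- The pressure. -/
  p : ℝ → ℝ³ → ℝ
  /-- The lifespan is positive. -/
  pos : 0 < T
  /-- `(u, p)` is a solution of the class on `timeSet T`. -/
  sol : IsCylinderEulerSolution L (timeSet T) u₀ u p
  /-- The pressure is normalised at the axis point `0`. -/
  normalised : ∀ t ∈ timeSet T, p t 0 = 0

namespace CylinderEulerCandidate

variable {L : ℝ} {u₀ : ℝ³ → ℝ³}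

/-- Candidates are preordered by **extension**: `a ≤ b` iff `b` lives at least as long and its
velocity and pressure agree with those of `a` on `timeSet a.T × closure {r < 1}`. [folklore] -/
instance : Preorder (CylinderEulerCandidate L u₀) where
  le a b := a.T ≤ b.T ∧ ∀ t ∈ timeSet a.T, ∀ y ∈ closure (unitCylinder : Set ℝ³),
    a.u t y = b.u t y ∧ a.p t y = b.p t y
  le_refl a := ⟨le_rfl, fun _ _ _ _ => ⟨rfl, rfl⟩⟩
  le_trans a b c hab hbc := ⟨hab.1.trans hbc.1, fun t ht y hy =>
    ⟨(hab.2 t ht y hy).1.trans (hbc.2 t (timeSet_mono hab.1 ht) y hy).1,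
      (hab.2 t ht y hy).2.trans (hbc.2 t (timeSet_mono hab.1 ht) y hy).2⟩⟩

/-- Unfolding the extension order. [folklore] -/
theorem le_def {a b : CylinderEulerCandidate L u₀} :
    a ≤ b ↔ a.T ≤ b.T ∧ ∀ t ∈ timeSet a.T, ∀ y ∈ closure (unitCylinder : Set ℝ³),
      a.u t y = b.u t y ∧ a.p t y = b.p t y :=
  Iff.rfl

/-- A solution of the class on a bounded `[0, T)` gives a candidate (normalise the pressure,
`IsCylinderEulerSolution.normalise`). [folklore] -/
def ofIco {T : ℝ} {u : ℝ → ℝ³ → ℝ³} {p : ℝ → ℝ³ → ℝ} (hT : 0 < T)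
    (h : IsCylinderEulerSolution L (Ico 0 T) u₀ u p) : CylinderEulerCandidate L u₀ where
  T := ENNReal.ofReal T
  u := u
  p := fun t x => p t x - p t 0
  pos := by simpa using hT
  sol := by
    rw [timeSet_ofReal hT]
    exact h.normalise
  normalised _ _ := sub_self _

open Classical in
/-- The velocity of the union of a family of candidates: at time `t`, the velocity of some
member alive at `t` (junk `0` if none is). [folklore] -/
def chainVelocity (c : Set (CylinderEulerCandidate L u₀)) (t : ℝ) : ℝ³ → ℝ³ :=
  if h : ∃ a ∈ c, t ∈ timeSet a.T then h.choose.u t else 0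

open Classical in
/-- The pressure of the union of a family of candidates: at time `t`, the pressure of the same
member alive at `t` (junk `0` if none is). [folklore] -/
def chainPressure (c : Set (CylinderEulerCandidate L u₀)) (t : ℝ) : ℝ³ → ℝ :=
  if h : ∃ a ∈ c, t ∈ timeSet a.T then h.choose.p t else 0

/-- The selected member at an alive time. [folklore] -/
theorem chainVelocity_eq (c : Set (CylinderEulerCandidate L u₀)) {t : ℝ}
    (h : ∃ a ∈ c, t ∈ timeSet a.T) : chainVelocity c t = h.choose.u t :=
  dif_pos h

/-- The selected member at an alive time. [folklore] -/
theorem chainPressure_eq (c : Set (CylinderEulerCandidate L u₀)) {t : ℝ}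
    (h : ∃ a ∈ c, t ∈ timeSet a.T) : chainPressure c t = h.choose.p t :=
  dif_pos h

/-- **Coherence of a chain**: on `timeSet a.T × closure {r < 1}` the union fields of a chain
agree with those of any member `a` (two members are comparable, and the smaller one's fields
are extended by the larger one's). [folklore] -/
theorem chain_coherent {c : Set (CylinderEulerCandidate L u₀)} (hc : IsChain (· ≤ ·) c)
    {a : CylinderEulerCandidate L u₀} (ha : a ∈ c) {t : ℝ} (ht : t ∈ timeSet a.T) {y : ℝ³}
    (hy : y ∈ closure (unitCylinder : Set ℝ³)) :
    chainVelocity c t y = a.u t y ∧ chainPressure c t y = a.p t y := by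
  have h : ∃ a ∈ c, t ∈ timeSet a.T := ⟨a, ha, ht⟩
  obtain ⟨hb, htb⟩ := h.choose_spec
  rw [chainVelocity_eq c h, chainPressure_eq c h]
  rcases hc.total ha hb with hab | hba
  · exact ⟨((le_def.1 hab).2 t ht y hy).1.symm, ((le_def.1 hab).2 t ht y hy).2.symm⟩
  · exact (le_def.1 hba).2 t htb y hy

/-- **The union of a nonempty chain is a solution of the class** on `timeSet (⨆ T)`: joint
smoothness is local (each `timeSet aᵢ.T × closure Ω` is relatively open and there the union is
`aᵢ`), the momentum equation at `t` is that of the member selected at `t` (the one-sided time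
derivative within the big time set only sees times below `aᵢ.T`, `timeDerivWithin_eq_of_eqOn`),
and all slice-wise clauses are those of the selected member. [folklore] -/
theorem isCylinderEulerSolution_chain {c : Set (CylinderEulerCandidate L u₀)}
    (hc : IsChain (· ≤ ·) c) (hne : c.Nonempty) :
    IsCylinderEulerSolution L (timeSet (⨆ a ∈ c, a.T)) u₀ (chainVelocity c) (chainPressure c) := by
  set T : ℝ≥0∞ := ⨆ a ∈ c, a.T with hT
  set K : Set ℝ³ := closure (unitCylinder : Set ℝ³) with hK
  have hle : ∀ a ∈ c, a.T ≤ T := fun a ha => le_biSup (fun a : CylinderEulerCandidate L u₀ => a.T) ha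
  have alive : ∀ {t : ℝ}, t ∈ timeSet T → ∃ a ∈ c, t ∈ timeSet a.T := fun ht => by
    obtain ⟨a, ha, hta⟩ := lt_biSup_iff.1 ht.2
    exact ⟨a, ha, ht.1, hta⟩
  -- the union agrees with the selected member `b` at time `t`, and with `b` at all of `b`'s times
  have sel : ∀ {t : ℝ} (h : ∃ a ∈ c, t ∈ timeSet a.T),
      chainVelocity c t = h.choose.u t ∧ chainPressure c t = h.choose.p t := fun h =>
    ⟨chainVelocity_eq c h, chainPressure_eq c h⟩
  -- time derivative of the union at an alive time
  have deriv : ∀ {a : CylinderEulerCandidate L u₀}, a ∈ c → ∀ {t : ℝ}, t ∈ timeSet a.T →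
      ∀ {x : ℝ³}, x ∈ (unitCylinder : Set ℝ³) →
      timeDerivWithin (timeSet a.T) a.u t x = timeDerivWithin (timeSet T) (chainVelocity c) t x :=
    fun {a} ha {t} ht {x} hx =>
    timeDerivWithin_eq_of_eqOn (timeSet_mono (hle a ha))
      ((isOpen_setOf_ofReal_lt a.T).mem_nhds ht.2)
      (timeSet_inter_setOf_lt (hle a ha)).subset
      (fun s hs => (chain_coherent hc ha hs (subset_closure hx)).1.symm) ht
  -- joint smoothness, velocity and pressure
  have piece : ∀ {a : CylinderEulerCandidate L u₀}, a ∈ c →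
      (timeSet T ×ˢ K) ∩ ({s : ℝ | ENNReal.ofReal s < a.T} ×ˢ (univ : Set ℝ³)) =
        timeSet a.T ×ˢ K := fun {a} ha => by
    rw [prod_inter_prod, inter_univ, timeSet_inter_setOf_lt (hle a ha)]
  have hsu : ContDiffOn ℝ ∞ (uncurry (chainVelocity c)) (timeSet T ×ˢ K) := by
    refine contDiffOn_of_locally_contDiffOn fun z hz => ?_
    obtain ⟨a, ha, hta⟩ := alive hz.1
    refine ⟨{s : ℝ | ENNReal.ofReal s < a.T} ×ˢ univ, (isOpen_setOf_ofReal_lt a.T).prod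
      isOpen_univ, ⟨hta.2, mem_univ _⟩, ?_⟩
    rw [piece ha]
    exact a.sol.smooth_velocity.congr fun w hw => (chain_coherent hc ha hw.1 hw.2).1
  have hsp : ContDiffOn ℝ ∞ (uncurry (chainPressure c)) (timeSet T ×ˢ K) := by
    refine contDiffOn_of_locally_contDiffOn fun z hz => ?_
    obtain ⟨a, ha, hta⟩ := alive hz.1
    refine ⟨{s : ℝ | ENNReal.ofReal s < a.T} ×ˢ univ, (isOpen_setOf_ofReal_lt a.T).prod
      isOpen_univ, ⟨hta.2, mem_univ _⟩, ?_⟩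
    rw [piece ha]
    exact a.sol.smooth_pressure.congr fun w hw => (chain_coherent hc ha hw.1 hw.2).2
  obtain ⟨a₀, ha₀⟩ := hne
  have h0 : ∃ a ∈ c, (0 : ℝ) ∈ timeSet a.T := ⟨a₀, ha₀, zero_mem_timeSet a₀.pos⟩
  refine ⟨⟨⟨hsu.of_le (by exact_mod_cast le_top), hsp.of_le (by exact_mod_cast le_top)⟩,
    fun t ht x hx => ?_, fun t ht x hx => ?_, fun t ht x hx => ?_⟩, ?_, hsu, hsp, fun t ht => ?_⟩
  · -- momentum
    obtain ⟨hb, htb⟩ := (alive ht).choose_spec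
    rw [(sel (alive ht)).1, (sel (alive ht)).2, ← deriv hb htb hx]
    exact (alive ht).choose.sol.euler.momentum t htb x hx
  · -- incompressibility
    rw [(sel (alive ht)).1]
    exact (alive ht).choose.sol.euler.divFree t (alive ht).choose_spec.2 x hx
  · -- slip
    rw [(sel (alive ht)).1]
    exact (alive ht).choose.sol.euler.slip t (alive ht).choose_spec.2 x hx
  · -- datum
    rw [(sel h0).1]
    exact h0.choose.sol.initial
  · -- symmetries
    rw [(sel (alive ht)).1, (sel (alive ht)).2]
    exact (alive ht).choose.sol.symmetric t (alive ht).choose_spec.2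

/-- **Upper bound of a nonempty chain**: the union candidate, living up to `⨆ aᵢ.T`. [folklore] -/
def chainSup (c : Set (CylinderEulerCandidate L u₀)) (hc : IsChain (· ≤ ·) c) (hne : c.Nonempty) :
    CylinderEulerCandidate L u₀ where
  T := ⨆ a ∈ c, a.T
  u := chainVelocity c
  p := chainPressure c
  pos := hne.some.pos.trans_le (le_biSup (fun a : CylinderEulerCandidate L u₀ => a.T) hne.some_mem)
  sol := isCylinderEulerSolution_chain hc hne
  normalised t ht := by
    have h : ∃ a ∈ c, t ∈ timeSet a.T := by
      obtain ⟨a, ha, hta⟩ := lt_biSup_iff.1 ht.2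
      exact ⟨a, ha, ht.1, hta⟩
    rw [chainPressure_eq c h]
    exact h.choose.normalised t h.choose_spec.2

/-- Every member of a nonempty chain lies below its union. [folklore] -/
theorem le_chainSup {c : Set (CylinderEulerCandidate L u₀)} (hc : IsChain (· ≤ ·) c)
    (hne : c.Nonempty) {a : CylinderEulerCandidate L u₀} (ha : a ∈ c) : a ≤ chainSup c hc hne :=
  ⟨le_biSup (fun a : CylinderEulerCandidate L u₀ => a.T) ha, fun _ ht _ hy =>
    ⟨(chain_coherent hc ha ht hy).1.symm, (chain_coherent hc ha ht hy).2.symm⟩⟩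

/-- **Existence of a maximal candidate** (Zorn's lemma, `zorn_le_nonempty`), given one
candidate. [folklore] -/
theorem exists_isMax (a : CylinderEulerCandidate L u₀) : ∃ m : CylinderEulerCandidate L u₀, IsMax m := by
  haveI : Nonempty (CylinderEulerCandidate L u₀) := ⟨a⟩
  exact zorn_le_nonempty fun c hc hne => ⟨chainSup c hc hne, fun b hb => le_chainSup hc hne hb⟩

end CylinderEulerCandidate

/-! ### The target fact from local existence and continuation -/

/-- **`Ferrari1993_periodicCylinderEulerBKM` from local existence and continuation.** Given local
existence in the class — hypothesis `hA`: for a smooth axisymmetric velocity field `u₀` on `ℝ³`,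
`L`-periodic in `z` (`L > 0`), divergence free in `{r < 1}` and tangential on `{r = 1}`, there are
`T > 0` and a solution of the class `IsCylinderEulerSolution L [0, T) u₀` (Kato–Lai 1984, Thm I:
for a bounded domain `Ω ⊂ ℝ^m` with smooth boundary, `s ≥ s₀ = [m/2] + 2`, `φ ∈ H^s_σ`, there are
`T > 0` and a unique solution `u ∈ C([0,T]; H^s_σ)`, `T` depending only on the `H^{s₀}` size of
the data; Thm II: `u(t) ∈ C^∞(Ω̄)` for `C^∞` data — p. 17; quoted with the pressure as Ferrari
1993, Thm 1, p. 279; the symmetries propagate by the uniqueness clause of Thm I; supplied in the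
tree by `KatoLai1984_periodicCylinderLocalExistence_of_uniformExistence` of
`KatoLaiUniformExistenceBridge.lean` from the named fact `KatoLai1984_periodicCylinderUniformExistence`)
— and the continuation fact (Ferrari 1993 Thm 2 in the periodic cylinder), smooth admissible data
launch a classical solution of the class which is either global or lives on a bounded `[0, T_m)`
with `sup_{[0,T_m) × {r<1}} |ω| = ∞`: take a maximal candidate (`CylinderEulerCandidate.exists_isMax`);
if its lifespan is `⊤` it is global; otherwise a vorticity bound on `[0, T_m)` would, by the
continuation fact, produce a solution on a longer `[0, T')` with the same velocity on
`[0, T_m) × closure {r<1}`, hence the same normalised pressure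
(`pressure_sub_apply_zero_eq_of_velocity_eq`), i.e. a strictly larger candidate — contradicting
maximality (Ferrari 1993, p. 277 and Thm 2; Beale–Kato–Majda 1984 §1). [cite: Ferrari1993, Thm 2 (p. 279) and p. 277 (maximal interval of existence)]
[cite: KatoLai1984, Thm I and Thm II (p. 17) (local existence hypothesis)] -/
theorem Ferrari1993_periodicCylinderEulerBKM_of_localExistence_of_continuation
    (hA : ∀ (L : ℝ) (_hL : 0 < L) (u₀ : ℝ³ → ℝ³) (_hsmooth : ContDiff ℝ ∞ u₀)
      (_haxi : IsAxisymmetric u₀) (_hper : IsAxiallyPeriodic L u₀)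
      (_hdiv : ∀ x ∈ (unitCylinder : Set ℝ³), VectorCalculus.divergence u₀ x = 0)
      (_hslip : ∀ x ∈ frontier (unitCylinder : Set ℝ³), ⟪u₀ x, eR x⟫ = 0),
      ∃ T : ℝ, 0 < T ∧ ∃ (u : ℝ → ℝ³ → ℝ³) (p : ℝ → ℝ³ → ℝ),
        IsCylinderEulerSolution L (Ico 0 T) u₀ u p)
    (hB : Ferrari1993_periodicCylinderContinuation) : Ferrari1993_periodicCylinderEulerBKM := by
  intro L hL u₀ hsm hax hper hdiv hslip
  obtain ⟨T₀, hT₀, v, q, hv⟩ := hA L hL u₀ hsm hax hper hdiv hslip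
  obtain ⟨m, hm⟩ := CylinderEulerCandidate.exists_isMax (CylinderEulerCandidate.ofIco hT₀ hv)
  by_cases htop : m.T = ⊤
  · -- global solution
    have hsol := m.sol
    rw [htop, timeSet_top] at hsol
    exact ⟨Ici 0, m.u, m.p, Or.inl rfl, hsol.euler, hsol.initial, hsol.smooth_velocity,
      hsol.smooth_pressure, hsol.symmetric⟩
  · -- maximal solution on a bounded interval
    have hTm0 : 0 < m.T.toReal := ENNReal.toReal_pos m.pos.ne' htop
    have hmT : m.T = ENNReal.ofReal m.T.toReal := (ENNReal.ofReal_toReal htop).symm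
    have hmS : timeSet m.T = Ico 0 m.T.toReal := by rw [hmT, timeSet_ofReal hTm0, ← hmT]
    have hsol := m.sol
    rw [hmS] at hsol
    refine ⟨Ico 0 m.T.toReal, m.u, m.p, Or.inr ⟨m.T.toReal, hTm0, rfl, ?_⟩, hsol.euler,
      hsol.initial, hsol.smooth_velocity, hsol.smooth_pressure, hsol.symmetric⟩
    by_contra hbdd
    push Not at hbdd
    obtain ⟨T', hT', u', p', hsol', hagree⟩ := hB L hL u₀ m.T.toReal hTm0 m.u m.p hsol hbdd
    -- the continuation is a candidate strictly above the maximal one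
    have hmb : m ≤ CylinderEulerCandidate.ofIco (hTm0.trans hT') hsol' := by
      rw [CylinderEulerCandidate.le_def]
      refine ⟨?_, fun t ht y hy => ?_⟩
      · show m.T ≤ ENNReal.ofReal T'
        rw [hmT]
        exact ENNReal.ofReal_le_ofReal hT'.le
      · rw [hmS] at ht
        refine ⟨(hagree t ht y hy).symm, ?_⟩
        show m.p t y = p' t y - p' t 0
        have key := hsol.euler.pressure_sub_apply_zero_eq_of_velocity_eq hsol'.euler
          (Ico_subset_Ico_right hT'.le) ht (Iio_mem_nhds ht.2) (fun s hs => ⟨hs.1.1, hs.2⟩)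
          (fun s hs z hz => (hagree s hs z hz).symm) hy
        rwa [m.normalised t (hmS ▸ ht), sub_zero] at key
    have hbm := (CylinderEulerCandidate.le_def.1 (hm hmb)).1
    change ENNReal.ofReal T' ≤ m.T at hbm
    rw [hmT, ENNReal.ofReal_le_ofReal_iff hTm0.le] at hbm
    exact absurd hT' (not_lt.2 hbm)

/-- **`chen_hou_blowup` (ns.S29 (ii)) from local existence, continuation and the Chen–Hou
a-priori estimates**: composition of
`Ferrari1993_periodicCylinderEulerBKM_of_localExistence_of_continuation` (same local-existence
hypothesis `hA`, Kato–Lai 1984 Thm I/II in the axisymmetric class) with `chen_hou_blowup_of_parts`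
(`ChenHouContinuation.lean`). The trust base of a dependent taking these three hypotheses is:
Kato–Lai 1984 Thm I/II and Ferrari 1993 Thm 2 in the periodic cylinder, and Chen–Hou's
computer-assisted Theorem 4. [cite: arXiv221007191, §1 Theorem 2 (p. 3) and §6.1 Theorem 4 (p. 54)] -/
theorem chen_hou_blowup_of_localExistence_of_continuation
    (hA : ∀ (L : ℝ) (_hL : 0 < L) (u₀ : ℝ³ → ℝ³) (_hsmooth : ContDiff ℝ ∞ u₀)
      (_haxi : IsAxisymmetric u₀) (_hper : IsAxiallyPeriodic L u₀)
      (_hdiv : ∀ x ∈ (unitCylinder : Set ℝ³), VectorCalculus.divergence u₀ x = 0)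
      (_hslip : ∀ x ∈ frontier (unitCylinder : Set ℝ³), ⟪u₀ x, eR x⟫ = 0),
      ∃ T : ℝ, 0 < T ∧ ∃ (u : ℝ → ℝ³ → ℝ³) (p : ℝ → ℝ³ → ℝ),
        IsCylinderEulerSolution L (Ico 0 T) u₀ u p)
    (hB : Ferrari1993_periodicCylinderContinuation)
    (hCH : ChenHou2022_aprioriBlowupEstimates) : chen_hou_blowup :=
  chen_hou_blowup_of_parts
    (Ferrari1993_periodicCylinderEulerBKM_of_localExistence_of_continuation hA hB) hCH

end Literature.Analysis.FluidPDE
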